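import Summits.QuantumFields.QCD.Theorems.HeatSlicedQuarksQuarkLoopCoefficientDefs

/-!
# Quark-loop coefficient, stub `secondOrderCoefficient`, part E: the Brillouin zone and the free symbol

Helper file of the line `Sketch` of crux stmt-QuantumFields-16786 (stub `stub_secondOrderCoefficient`).
Measure-theoretic and elementary analytic facts about the Brillouin zone `brillouin = [−π,π]⁴` and the
free Wilson symbol `hsymb p = Σ sin² p_μ + (Σ (1 − cos p_μ))²` used in the Laplace asymptotics of the free
kernel `freeKer`: measurability/compactness of the zone, continuity of the symbol, the zone lower bound
`h(p) ≥ (4/π²)|p|²`, the Taylor bound `|h(p) − |p|²| ≤ |p|⁴`, the Gaussian integral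
`∫_{ℝ⁴} e^{−b|p|²} dp = (π/b)²`, and the sup bounds `y e^{−y} ≤ 1`, `y² e^{−y} ≤ 2`.
Mathlib only (plus the Defs file).
-/

noncomputable section

namespace Summit.QuantumFields.QCD.Cruxes.QuarkLoopCoefficient.Sketch.SecondOrderCoefficient

open MeasureTheory Summit.QuantumFields.QCD.Theorems.QuarkLoopCoefficient

/-! ## The Brillouin zone -/

/-- The Brillouin zone is measurable. -/
theorem measurableSet_brillouin : MeasurableSet brillouin :=
  MeasurableSet.univ_pi fun _ => measurableSet_Icc

/-- The Brillouin zone is compact. -/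
theorem isCompact_brillouin : IsCompact brillouin :=
  isCompact_univ_pi fun _ => isCompact_Icc

/-- The Brillouin zone has finite volume. -/
theorem volume_brillouin_lt_top : volume brillouin < ⊤ :=
  isCompact_brillouin.measure_lt_top

/-- Membership in the Brillouin zone. -/
theorem mem_brillouin {p : Fin 4 → ℝ} : p ∈ brillouin ↔ ∀ μ : Fin 4, |p μ| ≤ Real.pi := by
  simp only [brillouin, Set.mem_univ_pi, Set.mem_Icc, abs_le]

/-- Off the Brillouin zone some coordinate exceeds `π` in absolute value. -/
theorem exists_pi_lt_abs_of_not_mem_brillouin {p : Fin 4 → ℝ} (hp : p ∉ brillouin) :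
    ∃ μ : Fin 4, Real.pi < |p μ| := by
  by_contra h
  push Not at h
  exact hp (mem_brillouin.mpr h)

/-! ## The free symbol -/

/-- The free symbol is continuous. -/
theorem continuous_hsymb : Continuous hsymb := by
  unfold hsymb; fun_prop

/-- The free symbol is nonnegative. -/
theorem hsymb_nonneg (p : Fin 4 → ℝ) : 0 ≤ hsymb p := by
  unfold hsymb; positivity

/-- `sin² x + (1 − cos x)² = 2(1 − cos x)`. -/
theorem sin_sq_add_one_sub_cos_sq (x : ℝ) : Real.sin x ^ 2 + (1 - Real.cos x) ^ 2 = 2 * (1 - Real.cos x) := by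
  nlinarith [Real.sin_sq_add_cos_sq x]

/-- For nonnegative terms, `Σ a_μ² ≤ (Σ a_μ)²`. -/
theorem sum_sq_le_sq_sum {a : Fin 4 → ℝ} (ha : ∀ μ, 0 ≤ a μ) : ∑ μ, a μ ^ 2 ≤ (∑ μ, a μ) ^ 2 := by
  rw [sq, Finset.sum_mul]
  refine Finset.sum_le_sum fun μ _ => ?_
  rw [sq]
  exact mul_le_mul_of_nonneg_left (Finset.single_le_sum (fun ν _ => ha ν) (Finset.mem_univ μ)) (ha μ)

/-- **Zone lower bound** `h(p) ≥ (4/π²) |p|²` on the Brillouin zone (from `sin² + (1−cos)² = 2(1 − cos)` and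
`cos x ≤ 1 − (2/π²)x²` for `|x| ≤ π`). -/
theorem mul_sum_sq_le_hsymb {p : Fin 4 → ℝ} (hp : p ∈ brillouin) :
    4 / Real.pi ^ 2 * ∑ μ, p μ ^ 2 ≤ hsymb p := by
  rw [mem_brillouin] at hp
  have h1 : ∀ μ, 4 / Real.pi ^ 2 * p μ ^ 2 ≤ Real.sin (p μ) ^ 2 + (1 - Real.cos (p μ)) ^ 2 := fun μ => by
    rw [sin_sq_add_one_sub_cos_sq]
    have := Real.cos_le_one_sub_mul_cos_sq (hp μ)
    have e : 4 / Real.pi ^ 2 * p μ ^ 2 = 2 * (2 / Real.pi ^ 2 * p μ ^ 2) := by ring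
    rw [e]
    linarith
  calc 4 / Real.pi ^ 2 * ∑ μ, p μ ^ 2 = ∑ μ, 4 / Real.pi ^ 2 * p μ ^ 2 := Finset.mul_sum _ _ _
    _ ≤ ∑ μ, (Real.sin (p μ) ^ 2 + (1 - Real.cos (p μ)) ^ 2) := Finset.sum_le_sum fun μ _ => h1 μ
    _ = (∑ μ, Real.sin (p μ) ^ 2) + ∑ μ, (1 - Real.cos (p μ)) ^ 2 := Finset.sum_add_distrib
    _ ≤ hsymb p := by
        unfold hsymb
        have := sum_sq_le_sq_sum (a := fun μ => 1 - Real.cos (p μ)) fun μ => by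
          have := Real.cos_le_one (p μ); linarith
        linarith

/-- `4/π² ≤ 1`. -/
theorem four_div_pi_sq_le_one : 4 / Real.pi ^ 2 ≤ 1 := by
  rw [div_le_one (by positivity)]
  nlinarith [Real.pi_gt_three]

/-- `0 < 4/π²`. -/
theorem four_div_pi_sq_pos : 0 < 4 / Real.pi ^ 2 := by positivity

/-- `|sin² x − x²| ≤ x⁴/3`. -/
theorem abs_sin_sq_sub_sq_le (x : ℝ) : |Real.sin x ^ 2 - x ^ 2| ≤ x ^ 4 / 3 := by
  have h1 : Real.sin x ^ 2 - x ^ 2 = (Real.sin x - x) * (Real.sin x + x) := by ring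
  rw [h1, abs_mul]
  have h2 : |Real.sin x - x| ≤ |x| ^ 3 / 6 := by rw [abs_sub_comm]; exact Real.abs_sub_sin_le x
  have h3 : |Real.sin x + x| ≤ 2 * |x| := by
    calc |Real.sin x + x| ≤ |Real.sin x| + |x| := abs_add_le _ _
      _ ≤ |x| + |x| := add_le_add Real.abs_sin_le_abs le_rfl
      _ = 2 * |x| := by ring
  calc |Real.sin x - x| * |Real.sin x + x| ≤ |x| ^ 3 / 6 * (2 * |x|) :=
        mul_le_mul h2 h3 (abs_nonneg _) (by positivity)
    _ = x ^ 4 / 3 := by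
        have : |x| ^ 4 = x ^ 4 := by rw [← abs_pow, abs_of_nonneg (by positivity)]
        rw [← this]; ring

/-- `0 ≤ 1 − cos x ≤ x²/2`. -/
theorem one_sub_cos_le_sq_div_two (x : ℝ) : 1 - Real.cos x ≤ x ^ 2 / 2 := by
  have := Real.one_sub_sq_div_two_le_cos (x := x); linarith

/-- `Σ_μ p_μ⁴ ≤ (Σ_μ p_μ²)²`. -/
theorem sum_pow_four_le_sq_sum_sq (p : Fin 4 → ℝ) : ∑ μ, p μ ^ 4 ≤ (∑ μ, p μ ^ 2) ^ 2 := by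
  have := sum_sq_le_sq_sum (a := fun μ => p μ ^ 2) fun μ => sq_nonneg _
  simpa [← pow_mul] using this

/-- **Taylor bound at the origin**: `|h(p) − |p|²| ≤ |p|⁴` for all `p`. -/
theorem abs_hsymb_sub_sum_sq_le (p : Fin 4 → ℝ) :
    |hsymb p - ∑ μ, p μ ^ 2| ≤ (∑ μ, p μ ^ 2) ^ 2 := by
  unfold hsymb
  have hW0 : 0 ≤ ∑ μ, (1 - Real.cos (p μ)) :=
    Finset.sum_nonneg fun μ _ => by have := Real.cos_le_one (p μ); linarith
  have hW1 : ∑ μ, (1 - Real.cos (p μ)) ≤ (∑ μ, p μ ^ 2) / 2 := by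
    rw [Finset.sum_div]
    exact Finset.sum_le_sum fun μ _ => one_sub_cos_le_sq_div_two (p μ)
  have hS0 : 0 ≤ ∑ μ, p μ ^ 2 := Finset.sum_nonneg fun μ _ => sq_nonneg _
  have hA : |∑ μ, Real.sin (p μ) ^ 2 - ∑ μ, p μ ^ 2| ≤ (∑ μ, p μ ^ 2) ^ 2 / 3 := by
    rw [← Finset.sum_sub_distrib]
    calc |∑ μ, (Real.sin (p μ) ^ 2 - p μ ^ 2)| ≤ ∑ μ, |Real.sin (p μ) ^ 2 - p μ ^ 2| :=
          Finset.abs_sum_le_sum_abs _ _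
      _ ≤ ∑ μ, p μ ^ 4 / 3 := Finset.sum_le_sum fun μ _ => abs_sin_sq_sub_sq_le (p μ)
      _ = (∑ μ, p μ ^ 4) / 3 := by rw [Finset.sum_div]
      _ ≤ (∑ μ, p μ ^ 2) ^ 2 / 3 := by gcongr; exact sum_pow_four_le_sq_sum_sq p
  have hB : (∑ μ, (1 - Real.cos (p μ))) ^ 2 ≤ (∑ μ, p μ ^ 2) ^ 2 / 4 := by
    nlinarith
  rw [abs_le] at hA ⊢
  constructor <;> nlinarith [sq_nonneg (∑ μ, (1 - Real.cos (p μ)))]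

/-! ## Gaussian integrals on `ℝ⁴` -/

/-- `p ↦ e^{−b|p|²}` is integrable on `ℝ⁴` for `b > 0`. -/
theorem integrable_exp_neg_mul_sum_sq {b : ℝ} (hb : 0 < b) :
    Integrable (fun p : Fin 4 → ℝ => Real.exp (-(b * ∑ μ, p μ ^ 2))) := by
  have h : (fun p : Fin 4 → ℝ => Real.exp (-(b * ∑ μ, p μ ^ 2))) =
      fun p : Fin 4 → ℝ => ∏ μ, Real.exp (-b * p μ ^ 2) := by
    ext p
    rw [← Real.exp_sum, Finset.mul_sum, ← Finset.sum_neg_distrib]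
    refine congrArg Real.exp (Finset.sum_congr rfl fun μ _ => by ring)
  rw [h]
  exact Integrable.fintype_prod (f := fun _ : Fin 4 => fun x : ℝ => Real.exp (-b * x ^ 2))
    fun _ => integrable_exp_neg_mul_sq hb

/-- **The Gaussian integral on `ℝ⁴`**: `∫ e^{−b|p|²} dp = (π/b)²` for `b > 0`. -/
theorem integral_exp_neg_mul_sum_sq {b : ℝ} (hb : 0 < b) :
    ∫ p : Fin 4 → ℝ, Real.exp (-(b * ∑ μ, p μ ^ 2)) = (Real.pi / b) ^ 2 := by
  have h : (fun p : Fin 4 → ℝ => Real.exp (-(b * ∑ μ, p μ ^ 2))) =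
      fun p : Fin 4 → ℝ => ∏ μ, Real.exp (-b * p μ ^ 2) := by
    ext p
    rw [← Real.exp_sum, Finset.mul_sum, ← Finset.sum_neg_distrib]
    refine congrArg Real.exp (Finset.sum_congr rfl fun μ _ => by ring)
  rw [h, integral_fintype_prod_volume_eq_prod (𝕜 := ℝ) (fun _ : Fin 4 => fun x : ℝ => Real.exp (-b * x ^ 2))]
  simp only [integral_gaussian, Finset.prod_const, Finset.card_univ, Fintype.card_fin]
  rw [show (4 : ℕ) = 2 * 2 by norm_num, pow_mul, Real.sq_sqrt (by positivity)]

/-! ## Sup bounds -/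

/-- `y e^{−y} ≤ 1`. -/
theorem mul_exp_neg_le_one (y : ℝ) : y * Real.exp (-y) ≤ 1 := by
  have h := Real.add_one_le_exp y
  rw [Real.exp_neg, mul_inv_le_iff₀ (Real.exp_pos y)]
  linarith

/-- `y² e^{−y} ≤ 2` for `y ≥ 0`. -/
theorem sq_mul_exp_neg_le_two {y : ℝ} (hy : 0 ≤ y) : y ^ 2 * Real.exp (-y) ≤ 2 := by
  have h := Real.pow_div_factorial_le_exp y hy 2
  rw [Nat.factorial_two, Nat.cast_ofNat] at h
  rw [Real.exp_neg, mul_inv_le_iff₀ (Real.exp_pos y)]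
  linarith

/-- `|e^{−a} − e^{−b}| ≤ |a − b| e^{−min(a,b)}`. -/
theorem abs_exp_neg_sub_exp_neg_le (a b : ℝ) :
    |Real.exp (-a) - Real.exp (-b)| ≤ |a - b| * Real.exp (-min a b) := by
  wlog hab : a ≤ b generalizing a b
  · have h := this b a (le_of_not_ge hab)
    rwa [abs_sub_comm, abs_sub_comm b a, min_comm] at h
  rw [min_eq_left hab, abs_of_nonneg (sub_nonneg.mpr (Real.exp_le_exp.mpr (neg_le_neg hab))),
    abs_of_nonpos (sub_nonpos.mpr hab)]
  have h1 : Real.exp (-b) = Real.exp (-a) * Real.exp (-(b - a)) := by rw [← Real.exp_add]; ring_nf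
  rw [h1, ← mul_one_sub, mul_comm]
  refine mul_le_mul_of_nonneg_right ?_ (Real.exp_nonneg _)
  have := Real.add_one_le_exp (-(b - a))
  linarith

/-! ## Registered headline -/

/-- Registered headline of this helper file (aux stub `stub_secondOrderCoefficientAuxE` of crux
stmt-QuantumFields-16786, line `Sketch`): the Gaussian integral on `ℝ⁴`. -/
theorem stub_secondOrderCoefficientAuxE :
    ∀ (b : ℝ), 0 < b → ∫ p : Fin 4 → ℝ, Real.exp (-(b * ∑ μ, p μ ^ 2)) = (Real.pi / b) ^ 2 :=
  fun _ hb => integral_exp_neg_mul_sum_sq hb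

end Summit.QuantumFields.QCD.Cruxes.QuarkLoopCoefficient.Sketch.SecondOrderCoefficient

end
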